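import Summits.Langlands.Langlands.Theorems.PicardMuOrdinaryMuOrdinaryFamilyRTPointBorelLine

/-!
# The Picard point of line `free-seed-smooth-rt` (crux `MuOrdinaryFamilyRT`, stmt-Langlands-13757):
# LEAF `modelBorel` — the `Γ_λ`-Borel condition of the `𝒪₀`-model and its distinguished flag

Helper file for the registered stub `stub_point` (plan: `…PointPlan.lean`).  PROVED:
`theorem modelBorel : Leaf.modelBorel`.  For `R = ρ₁|Γ_{K_v}` (reducing to `r = r̄_f^B|Γ_{K_v}`,
distinguished residual flag `F₀`) triangularised over `ℚ̄₃` by `g`: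

* the stable line `c` (`exists_stable_integral_line`); the stable plane as the kernel of the stable line
  `y` of the contragredient (`trinv ∘ R`, residual frame `(F₀⁻¹)ᵀ w₀`, `ℚ̄₃`-frame `(g⁻¹)ᵀ w₀`, again
  `exists_stable_integral_line`), with `y ⬝ c = 0` (`(g⁻¹ g)₂₀ = 0`) and `y ⬝ R(τ)z = b(τ⁻¹) (y ⬝ z)`;
* a primitive `c₂` in the plane with `c₂(i₁) = 0` (`exists_primitive` applied to
  `y(q) e_p - y(p) e_q`), the unimodular frame `gU = (c, c₂, e_{i₃})` (`isUnit_det_frameOf`), upper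
  triangularity of `gU⁻¹ R gU` (`eq_combination_of_dot_eq_zero`, `isUpper3_conj_frameOf`);
* the reduction `F = gU mod 𝔪₀` is a stable flag, distinguished by `diag_pairwise_ne_of_conj` against
  `F₀`; and `F⁻¹ (gU mod 𝔪₀) = 1` is upper triangular.
-/

-- `Summit.Langlands.Langlands.…` (summit = sub-problem name, D-0017 layout) trips `dupNamespace` on every decl.
set_option linter.dupNamespace false

namespace Summit.Langlands.Langlands.Cruxes.MuOrdinaryFamilyRT.FreeSeedSmoothRt

open scoped Matrix NumberField Polynomial
open Field IsDedekindDomain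
open Literature.NumberTheory.GaloisRepresentations

noncomputable section

variable (ι : PadicAlgCl 3 ≃+* ℂ) (e : K →+* ℂ)

/-- **Primitive multiples**: a non-zero `z ∈ 𝒪₀³` is `z(i) • c` with `c(i) = 1`, for a coordinate `i`
of maximal norm. -/
theorem exists_primitive (z : Fin 3 → O₀ ι e) (hz : z ≠ 0) :
    ∃ (c : Fin 3 → O₀ ι e) (i : Fin 3), c i = 1 ∧ z i ≠ 0 ∧ z = z i • c := by
  obtain ⟨i, -, hi⟩ := Finset.exists_max_image Finset.univ (fun l => ‖j₀ ι e (z l)‖) Finset.univ_nonempty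
  have hzi : z i ≠ 0 := by
    intro h0; apply hz; funext l
    have := hi l (Finset.mem_univ l)
    rw [h0, map_zero, norm_zero] at this
    exact (map_eq_zero_iff _ (j₀_injective ι e)).mp (norm_le_zero_iff.mp this)
  have hji : j₀ ι e (z i) ≠ 0 := fun h => hzi ((map_eq_zero_iff _ (j₀_injective ι e)).mp h)
  have hmemE : ∀ l, j₀ ι e (z l) / j₀ ι e (z i) ∈ E₀ ι e := fun l => by
    rw [j₀_apply, j₀_apply]; exact div_mem (z l : E₀ ι e).2 (z i : E₀ ι e).2
  have hmemO : ∀ l, (⟨_, hmemE l⟩ : E₀ ι e) ∈ intermediateFieldIntegers 3 (E₀ ι e) := fun l => by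
    rw [mem_intermediateFieldIntegers_iff]
    change ‖j₀ ι e (z l) / j₀ ι e (z i)‖ ≤ 1
    rw [norm_div, div_le_one (norm_pos_iff.mpr hji)]
    exact hi l (Finset.mem_univ l)
  refine ⟨fun l => ⟨⟨_, hmemE l⟩, hmemO l⟩, i, ?_, hzi, ?_⟩
  · apply j₀_injective ι e
    rw [map_one]
    exact div_self hji
  · funext l
    apply j₀_injective ι e
    rw [Pi.smul_apply, smul_eq_mul, map_mul]
    change j₀ ι e (z l) = j₀ ι e (z i) * (j₀ ι e (z l) / j₀ ι e (z i))
    rw [mul_div_cancel₀ _ hji]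

/-- The reduction of a `GL₃(𝒪₀)`-conjugate is the conjugate of the reductions, entrywise. -/
theorem val_map_conj (π : O₀ ι e →+* ZMod 3) (g u : GL (Fin 3) (O₀ ι e)) :
    (Matrix.GeneralLinearGroup.map π (g⁻¹ * u * g)).val = ((g⁻¹ * u * g).val).map π := rfl

set_option maxHeartbeats 800000 in
/-- **LEAF `modelBorel`** (registered helper goal of `stub_point`): the `Γ_λ`-Borel condition of the
`𝒪₀`-model and the distinguished flag it reduces to. -/
theorem modelBorel : Leaf.modelBorel := by
  intro f ι e B F₀ v h3 hD ρ₁ hred hBorel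
  obtain ⟨g, hg⟩ := hBorel
  -- the local representation and its reduction
  set res := (absGaloisRestrict K (v.adicCompletion K)).toMonoidHom with hres
  set Rv : absoluteGaloisGroup (v.adicCompletion K) →* GL (Fin 3) (O₀ ι e) := ρ₁.comp res with hRv
  set rv : absoluteGaloisGroup (v.adicCompletion K) →* GL (Fin 3) (ZMod 3) := (rbar f B).comp res with hrv
  set π := algebraMap (O₀ ι e) (ZMod 3) with hπ
  have hRr : ∀ τ, (Rv τ).val.map π = (rv τ).val := fun τ => hred _
  have hRr' : ∀ τ, Matrix.GeneralLinearGroup.map π (Rv τ) = rv τ := fun τ => Units.ext (hRr τ)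
  have hF₀ : ∀ τ, IsUpper3 (F₀⁻¹ * rv τ * F₀).val := fun τ => hD.1 τ
  have hdist : ∀ i j : Fin 3, i ≠ j → (fun τ => (F₀⁻¹ * rv τ * F₀).val i i) ≠ fun τ => (F₀⁻¹ * rv τ * F₀).val j j :=
    fun i j hij => hD.2 i j hij
  have hg' : ∀ τ, IsUpper3 (g⁻¹ * Matrix.GeneralLinearGroup.map (j₀ ι e) (Rv τ) * g).val := fun τ => hg τ
  -- (1) the stable line
  obtain ⟨c, i₁, a, t, hc1, hRc, ht, hct⟩ := exists_stable_integral_line ι e Rv rv hRr F₀ hF₀ g hg' hdist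
  -- (2) the stable plane, through the dual
  set Rd : absoluteGaloisGroup (v.adicCompletion K) →* GL (Fin 3) (O₀ ι e) := trinv.comp Rv with hRd
  set rd : absoluteGaloisGroup (v.adicCompletion K) →* GL (Fin 3) (ZMod 3) := trinv.comp rv with hrd
  have hRrd : ∀ τ, (Rd τ).val.map π = (rd τ).val := fun τ => by
    change (Matrix.GeneralLinearGroup.map π (trinv (Rv τ))).val = (trinv (rv τ)).val
    rw [map_trinv, hRr']
  set F₀d : GL (Fin 3) (ZMod 3) := trinv F₀ * w₀ with hF₀d
  have hF₀d' : ∀ τ, IsUpper3 (F₀d⁻¹ * rd τ * F₀d).val := fun τ => isUpper3_dualFrame F₀ (rv τ) (hF₀ τ)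
  have hdistd : ∀ i j : Fin 3, i ≠ j → (fun τ => (F₀d⁻¹ * rd τ * F₀d).val i i) ≠ fun τ => (F₀d⁻¹ * rd τ * F₀d).val j j := by
    intro i j hij hEq
    apply hdist (Fin.rev i) (Fin.rev j) (fun h => hij (Fin.rev_injective h))
    funext τ
    have := congrFun hEq τ
    simp only [hrd, MonoidHom.comp_apply] at this
    rw [hF₀d, dualFrame_diag F₀ (rv τ) (hF₀ τ), dualFrame_diag F₀ (rv τ) (hF₀ τ)] at this
    exact inv_injective this
  set gd : GL (Fin 3) (PadicAlgCl 3) := trinv g * w₀ with hgd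
  have hgd' : ∀ τ, IsUpper3 (gd⁻¹ * Matrix.GeneralLinearGroup.map (j₀ ι e) (Rd τ) * gd).val := fun τ => by
    change IsUpper3 ((trinv g * w₀)⁻¹ * Matrix.GeneralLinearGroup.map (j₀ ι e) (trinv (Rv τ)) * (trinv g * w₀)).val
    rw [map_trinv]
    exact isUpper3_dualFrame g _ (hg' τ)
  obtain ⟨y, i₁', b, t', hy1, hRy, ht', hyt⟩ := exists_stable_integral_line ι e Rd rd hRrd F₀d hF₀d' gd hgd' hdistd
  have hy0 : y ≠ 0 := fun h0 => one_ne_zero (hy1.symm.trans (congrFun h0 i₁'))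
  -- (3) `y ⬝ c = 0` and `y ⬝ (R τ z) = b(τ⁻¹) (y ⬝ z)`
  have hgd0 : gd.val *ᵥ Pi.single 0 1 = fun i => (g⁻¹).val 2 i := by
    have hw : (w₀ : GL (Fin 3) (PadicAlgCl 3)).val *ᵥ Pi.single 0 1 = Pi.single 2 1 := by
      rw [Matrix.mulVec_single_one]; ext i; fin_cases i <;> simp [w₀]
    rw [hgd, Units.val_mul, ← Matrix.mulVec_mulVec, hw, trinv_val, Matrix.mulVec_single_one]
    rfl
  have hyc : y ⬝ᵥ c = 0 := by
    apply j₀_injective ι e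
    rw [map_zero, RingHom.map_dotProduct]
    change (fun i => j₀ ι e (y i)) ⬝ᵥ (fun i => j₀ ι e (c i)) = 0
    rw [hyt, hct, hgd0, smul_dotProduct, dotProduct_smul, Matrix.dotProduct_mulVec]
    have : Matrix.vecMul (fun i => (g⁻¹).val 2 i) g.val = fun j => (1 : Matrix (Fin 3) (Fin 3) (PadicAlgCl 3)) 2 j := by
      funext j
      rw [← Units.inv_mul g]
      rfl
    rw [this, dotProduct_single_one]
    simp
  have hyR : ∀ τ z, y ⬝ᵥ ((Rv τ).val *ᵥ z) = b τ⁻¹ * (y ⬝ᵥ z) := fun τ z => by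
    rw [Matrix.dotProduct_mulVec, ← Matrix.mulVec_transpose]
    have : (Rv τ).valᵀ = (Rd τ⁻¹).val := by
      change _ = (trinv (Rv τ⁻¹)).val
      rw [trinv_val, map_inv, inv_inv]
    rw [this, hRy, smul_dotProduct, smul_eq_mul]
  -- (4) a primitive `c₂` in the plane with `c₂(i₁) = 0`
  set p := i₁ + 1 with hp
  set q := i₁ + 2 with hq
  have hidx : ∀ m : Fin 3, m ≠ m + 1 ∧ m ≠ m + 2 ∧ m + 1 ≠ m + 2 := by decide
  obtain ⟨hip, hiq, hpq⟩ := hidx i₁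
  set z₀ : Fin 3 → O₀ ι e := Pi.single p (y q) - Pi.single q (y p) with hz₀
  have hz₀i₁ : z₀ i₁ = 0 := by
    rw [hz₀, Pi.sub_apply, Pi.single_eq_of_ne hip, Pi.single_eq_of_ne hiq, sub_zero]
  have hyz₀ : y ⬝ᵥ z₀ = 0 := by
    rw [hz₀, dotProduct_sub, dotProduct_single, dotProduct_single]; ring
  have hz₀ne : z₀ ≠ 0 := by
    intro h0
    have hq0 : y q = 0 := by
      have := congrFun h0 p
      rwa [hz₀, Pi.sub_apply, Pi.zero_apply, Pi.single_eq_same, Pi.single_eq_of_ne hpq, sub_zero] at this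
    have hp0 : y p = 0 := by
      have := congrFun h0 q
      rwa [hz₀, Pi.sub_apply, Pi.zero_apply, Pi.single_eq_of_ne hpq.symm, Pi.single_eq_same, zero_sub,
        neg_eq_zero] at this
    have hsum : y ⬝ᵥ c = y i₁ * c i₁ + y p * c p + y q * c q := by
      rw [dotProduct, Fin.sum_univ_three, hp, hq]
      fin_cases i₁ <;> simp <;> ring
    rw [hyc, hc1, hp0, hq0] at hsum
    simp only [mul_one, zero_mul, add_zero] at hsum
    apply hy0
    funext l
    rcases Fin.eq_or_eq_or_eq_of_ne hip hiq hpq l with rfl | rfl | rfl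
    · exact hsum.symm
    · exact hp0
    · exact hq0
  obtain ⟨c₂, i₂, hc₂1, hz₀i₂, hz₀c₂⟩ := exists_primitive ι e z₀ hz₀ne
  have hc₂i₁ : c₂ i₁ = 0 := by
    have := congrFun hz₀c₂ i₁
    rw [hz₀i₁, Pi.smul_apply, smul_eq_mul] at this
    exact (mul_eq_zero.mp this.symm).resolve_left hz₀i₂
  have h₁₂ : i₁ ≠ i₂ := by
    intro h; rw [h, hc₂1] at hc₂i₁; exact one_ne_zero hc₂i₁
  have hyc₂ : y ⬝ᵥ c₂ = 0 := by
    have := hyz₀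
    rw [hz₀c₂, dotProduct_smul, smul_eq_mul] at this
    exact (mul_eq_zero.mp this).resolve_left hz₀i₂
  obtain ⟨i₃, h₁₃, h₂₃⟩ : ∃ i₃ : Fin 3, i₁ ≠ i₃ ∧ i₂ ≠ i₃ := by
    have : ∀ a b : Fin 3, ∃ c : Fin 3, a ≠ c ∧ b ≠ c := by decide
    exact this i₁ i₂
  -- (5) the frame
  have hdetF : IsUnit (frameOf c c₂ i₃).det := isUnit_det_frameOf h₁₂ h₁₃ h₂₃ c c₂ hc1 hc₂i₁ hc₂1
  set gU : GL (Fin 3) (O₀ ι e) := Matrix.nonsingInvUnit (frameOf c c₂ i₃) hdetF with hgU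
  have hgUval : gU.val = frameOf c c₂ i₃ := rfl
  have hup : ∀ τ, IsUpper3 (gU⁻¹ * Rv τ * gU).val := fun τ => by
    rw [Units.val_mul, Units.val_mul, Matrix.coe_units_inv, hgUval]
    obtain hcomb := eq_combination_of_dot_eq_zero h₁₂ h₁₃ h₂₃ c c₂ y hc1 hc₂i₁ hc₂1 hy0 hyc hyc₂ ((Rv τ).val *ᵥ c₂)
      (by rw [hyR, hyc₂, mul_zero])
    exact isUpper3_conj_frameOf c c₂ i₃ hdetF (Rv τ).val (a τ) _ _ (hRc τ) hcomb
  -- (6) the reduction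
  refine ⟨Matrix.GeneralLinearGroup.map π gU, gU, ⟨fun τ => ?_, ?_⟩, ?_, hup⟩
  · have e1 : (Matrix.GeneralLinearGroup.map π gU)⁻¹ * rbar f B (absGaloisRestrict K (v.adicCompletion K) τ) *
        Matrix.GeneralLinearGroup.map π gU = Matrix.GeneralLinearGroup.map π (gU⁻¹ * Rv τ * gU) := by
      rw [map_mul, map_mul, map_inv, hRr']; rfl
    rw [e1]
    obtain ⟨h10, h20, h21⟩ := hup τ
    refine ⟨?_, ?_, ?_⟩
    · change π ((gU⁻¹ * Rv τ * gU).val 1 0) = 0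
      rw [h10, map_zero]
    · change π ((gU⁻¹ * Rv τ * gU).val 2 0) = 0
      rw [h20, map_zero]
    · change π ((gU⁻¹ * Rv τ * gU).val 2 1) = 0
      rw [h21, map_zero]
  · -- distinct diagonal characters: the `3 × 3` matrix argument
    set F := Matrix.GeneralLinearGroup.map π gU with hF
    have hT₁ : ∀ τ, IsUpper3 (F⁻¹ * rv τ * F).val := fun τ => by
      have e1 : F⁻¹ * rv τ * F = Matrix.GeneralLinearGroup.map π (gU⁻¹ * Rv τ * gU) := by
        rw [map_mul, map_mul, map_inv, hRr']
      rw [e1]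
      obtain ⟨h10, h20, h21⟩ := hup τ
      refine ⟨?_, ?_, ?_⟩
      · change π ((gU⁻¹ * Rv τ * gU).val 1 0) = 0
        rw [h10, map_zero]
      · change π ((gU⁻¹ * Rv τ * gU).val 2 0) = 0
        rw [h20, map_zero]
      · change π ((gU⁻¹ * Rv τ * gU).val 2 1) = 0
        rw [h21, map_zero]
    have key := diag_pairwise_ne_of_conj (k := ZMod 3) (fun τ => (F₀⁻¹ * rv τ * F₀).val) (fun τ => (F⁻¹ * rv τ * F).val)
      hF₀ hT₁ (fun τ => ((Matrix.isUnit_iff_isUnit_det _).mp (F₀⁻¹ * rv τ * F₀).isUnit).ne_zero) (F₀⁻¹ * F).val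
      ((Matrix.isUnit_iff_isUnit_det _).mp (F₀⁻¹ * F).isUnit).ne_zero
      (fun τ => by rw [← Units.val_mul, ← Units.val_mul]; congr 1; group) hdist
    exact key
  · rw [inv_mul_cancel]
    exact ⟨Matrix.one_apply_ne (by decide), Matrix.one_apply_ne (by decide), Matrix.one_apply_ne (by decide)⟩

end

end Summit.Langlands.Langlands.Cruxes.MuOrdinaryFamilyRT.FreeSeedSmoothRt
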